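import Summits.ValiantsHypothesis.ValiantsHypothesis.Theorems.DivisionGapDefs
import Summits.ValiantsHypothesis.ValiantsHypothesis.Theorems.DivisionGapPerDivisionHardStubWalkStepMargins

/-!
# Route `DivisionGap`, crux `PerDivisionHard` (stmt-ValiantsHypothesis-5065) — vocabulary of the
GENERIC-CUT BARRIER of line `pair-descent-jss-endpoint` (seat c8): walk steps, closed
non-backtracking walks and the walk sum `W_L^{(R₀; ρ₀, a₀)}`

The barrier (`Cruxes/PerDivisionHard/NegativeNotes-genericCut-walkTwins.md`, dossier v8): the product over all
base rows `R₀`, bookkeeping rows `ρ₀ ≠ R₀`, default columns `a₀` and lengths `L = 4k'+2` of the closed walk sums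
below is a torus-homogeneous cofactor of polynomial monotone complexity which is non-rigid (two top monomials
differing ON the placed face) at every placement of every block gadget under every generic cut.  The registered
stubs `stub_walkStepMargins` (margins of `walkStep` do not depend on the step) and `stub_walkBookkeepingTwin`
(the bookkeeping part depends only on multisets) are stated inline in the skeleton; this file names the objects
so that torus-homogeneity of the walk sum and the reversal-twin identity can be stated about ONE declaration.
Nothing here asserts anything.

* `walkStep ρ₀ a₀ R Cᵢₙ Cₒᵤₜ` — the exponent vector
  `e_{(R,Cᵢₙ)} + 2 e_{(R,Cₒᵤₜ)} + Σ_{R'≠R} 3 e_{(R',a₀)} + Σ_{C≠Cᵢₙ} e_{(ρ₀,C)} + Σ_{C≠Cₒᵤₜ} 2 e_{(ρ₀,C)}`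
  of one row visit `R` entered through column `Cᵢₙ` and left through column `Cₒᵤₜ`: the visit cells plus the
  DEFAULT `x_{R' a₀}³` of every other row and the COMPLEMENTS in the bookkeeping row `ρ₀` that make the row
  margins `3` (`3n` at `ρ₀`) and the column margins `3` (`3n` at `a₀`) whatever the step is.
* `IsClosedNBWalk L R₀ rows cols` — `cols 0, rows 0 = R₀, cols 1, rows 1, …, rows (L-1), cols L = cols 0` is a
  closed walk that never re-uses the column it just used (`cols t ≠ cols (t+1)`), never stays in a row
  (`rows t ≠ rows (t+1)`), and closes without backtracking (`rows (L-1) ≠ rows 0` when `L ≥ 2`).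
* `walkExponent ρ₀ a₀ rows cols = Σ_t walkStep ρ₀ a₀ (rows t) (cols t) (cols (t+1))`.
* `closedWalkSum L R₀ ρ₀ a₀ = Σ_{closed NB walks} x^{walkExponent}` (coefficients `1`), a polynomial over `ℝ≥0`.

References: dossier v8 of the line; Jerrum–Snir 1982 §2 (weight functions / envelopes) for the role of margins.
-/

noncomputable section

-- `Summit.ValiantsHypothesis.ValiantsHypothesis.…` is the tree's mandated single-conjunct layout
-- (Sub = Summit), so the duplicated namespace component is intended.
set_option linter.dupNamespace false

namespace Summit.ValiantsHypothesis.ValiantsHypothesis.Theorems.DivisionGapPerDivisionHard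

open MvPolynomial Literature.Computability.AlgebraicComplexity
open scoped NNReal BigOperators

/-- The exponent vector of one WALK STEP with bookkeeping row `ρ₀` and default column `a₀`: the row `R` is
entered through column `Cᵢₙ` (multiplicity `1`) and left through column `Cₒᵤₜ` (multiplicity `2`); every
other row `R'` carries its default `3 e_{(R',a₀)}`, and the bookkeeping row carries the complements
`Σ_{C ≠ Cᵢₙ} e_{(ρ₀,C)} + Σ_{C ≠ Cₒᵤₜ} 2 e_{(ρ₀,C)}`.  Its row margins are `3` except `3n` at `ρ₀` and its column
margins are `3` except `3n` at `a₀`, for every `(R, Cᵢₙ, Cₒᵤₜ)` (registered stub `stub_walkStepMargins` of line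
`pair-descent-jss-endpoint`, which states this for the unfolded right-hand side). [folklore] -/
def walkStep {n : ℕ} (ρ₀ a₀ R Cin Cout : Fin n) : (Fin n × Fin n) →₀ ℕ :=
  Finsupp.single (R, Cin) 1 + Finsupp.single (R, Cout) 2 +
    ∑ R' ∈ Finset.univ.erase R, Finsupp.single (R', a₀) 3 +
    ∑ C ∈ Finset.univ.erase Cin, Finsupp.single (ρ₀, C) 1 +
    ∑ C ∈ Finset.univ.erase Cout, Finsupp.single (ρ₀, C) 2

/-- Sanity link with the registered stub `stub_walkStepMargins` (LANDED p131522): the margins of a walk step do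
not depend on the step — row degrees `3` except `3n` at the bookkeeping row, column degrees `3` except `3n` at
the default column.  Hence every `walkExponent` of length `L`, and every monomial of `closedWalkSum`, has row
margins `L • (3,…,3n,…,3)` and column margins `L • (3,…,3n,…,3)`. [folklore] -/
theorem walkStep_margins : ∀ (n : ℕ) (ρ₀ a₀ R Cin Cout : Fin n),
    (∀ r : Fin n, rowDegrees (walkStep ρ₀ a₀ R Cin Cout) r = if r = ρ₀ then 3 * n else 3) ∧
    (∀ c : Fin n, Finsupp.mapDomain Prod.snd (walkStep ρ₀ a₀ R Cin Cout) c = if c = a₀ then 3 * n else 3) :=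
  fun n ρ₀ a₀ R Cin Cout => stub_walkStepMargins n ρ₀ a₀ R Cin Cout _ rfl

/-- `rows : Fin L → Fin n` and `cols : Fin (L+1) → Fin n` form a CLOSED NON-BACKTRACKING WALK of length `L`
based at the row `R₀`: the walk is `cols 0, rows 0, cols 1, rows 1, …, rows (L-1), cols L` with `rows 0 = R₀`
(when `L ≥ 1`), it is closed (`cols L = cols 0`), consecutive columns differ (`cols t ≠ cols (t+1)`: the row
visit `rows t` uses two different cells), consecutive rows differ, and the last row differs from the first
(no backtracking through the closing column when `L ≥ 2`). [folklore] -/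
def IsClosedNBWalk {n : ℕ} (L : ℕ) (R₀ : Fin n) (rows : Fin L → Fin n) (cols : Fin (L + 1) → Fin n) : Prop :=
  (∀ h : 0 < L, rows ⟨0, h⟩ = R₀) ∧ cols (Fin.last L) = cols 0 ∧
    (∀ t : Fin L, cols t.castSucc ≠ cols t.succ) ∧
    (∀ t : Fin L, ∀ h : t.val + 1 < L, rows t ≠ rows ⟨t.val + 1, h⟩) ∧
    (∀ h : 1 < L, rows ⟨L - 1, by omega⟩ ≠ rows ⟨0, by omega⟩)

/-- The exponent vector of a walk: the sum of its steps, the `t`-th row visit `rows t` being entered through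
`cols t` and left through `cols (t+1)`. [folklore] -/
def walkExponent {n L : ℕ} (ρ₀ a₀ : Fin n) (rows : Fin L → Fin n) (cols : Fin (L + 1) → Fin n) :
    (Fin n × Fin n) →₀ ℕ :=
  ∑ t : Fin L, walkStep ρ₀ a₀ (rows t) (cols t.castSucc) (cols t.succ)

/-- The CLOSED WALK SUM `W_L^{(R₀; ρ₀, a₀)}`: the sum, over the closed non-backtracking walks of length `L` based at
row `R₀`, of the monomials `x^{walkExponent}` with coefficient `1`, a polynomial over `ℝ≥0` in the matrix
variables.  All its monomials have the same margins (torus-homogeneous); a closed walk and its reversal have the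
same exponent off the walk cells and differ by the walk's net flow (dossier v8 §1). [folklore] -/
def closedWalkSum (n L : ℕ) (R₀ ρ₀ a₀ : Fin n) : MvPolynomial (Fin n × Fin n) ℝ≥0 := by
  classical
  exact ∑ p ∈ (Finset.univ : Finset ((Fin L → Fin n) × (Fin (L + 1) → Fin n))).filter
      (fun p => IsClosedNBWalk L R₀ p.1 p.2),
    monomial (walkExponent ρ₀ a₀ p.1 p.2) (1 : ℝ≥0)

end Summit.ValiantsHypothesis.ValiantsHypothesis.Theorems.DivisionGapPerDivisionHard

end
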